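import Summits.BirchSwinnertonDyer.Rank1Residual.Supersingular.BlindPointFlatTwo
import Literature.NumberTheory.EllipticCurves.PadicFormalLogOrder
import Literature.NumberTheory.EllipticCurves.QuadraticTwist
import Literature.NumberTheory.EllipticCurves.BSDRootNumberSmallConductorProofs
import Literature.NumberTheory.EllipticCurves.Rank1Residual.Predicates
import Literature.NumberTheory.EllipticCurves.GlobalMinimalModel
import Literature.NumberTheory.EllipticCurves.FormalGroup
import HarnessLib

/-!
# Sketch42C — MEMO-an §42 (v2.01): the blind flat unit law as ONE statement, via the crystalline
# Frobenius of `E/ℤ₂` read off the FORMAL GROUP (Katz's Dieudonné module of `Ê`)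

MECHANISM (§42.1): on the odd-twist locus the stripped `D_cris`-valued leading term of the 2-adic
L-function of `E` at the wild quadratic character `ψ₂` is `b·ω − s′·φω` (`b = evalAt (−2) Lf`,
`s′ = derivAt (−2) Ls`, Sprung's `Log` at the singular layer); a Kobayashi-shaped p-adic
Gross–Zagier formula at `ψ₂` then gives `b = −κ₀·BSDq(E^{(2)})·log_ω(P₂)²/m₂₁` with
`m₂₁ = ⟨ω, φω⟩` the `η`-coordinate of `φ(ω)` in the basis `(ω, η = x·ω)` of `H¹_dR` of the minimal
model. Odd squares die mod 8, so `unit(b)·(m₂₁/2) ≡ const·Tam(E^{(2)})_odd (mod 8)`.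

HOW `m₂₁` IS TYPED WITHOUT CRYSTALLINE COHOMOLOGY (Katz, *Crystalline cohomology, Dieudonné modules,
and Jacobi sums* (1981), §§3–5; the generalized Atkin–Swinnerton-Dyer congruences): for `E/ℤ_p`
SUPERSINGULAR, `H¹_cris(E/ℤ_p) = D(Ê)` = {quasi-logarithms} / {integral series}, with basis the
formal logarithm `f₁ = ∫ω = log_W` (tree `formalLog`) and the regularised integral of the second-kind
differential `f₂ = ∫(x·ω + z⁻²dz·(−1)…)`, i.e. `f₂ = Σ_{N≥1} d(N)/N·z^N` where
`x(z)·ω(z)/dz = z⁻² + Σ_{N≥1} d(N) z^{N−1}` (tree: `d(N) = coeff (N+1) (formalXMulSq * formalOmega)`),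
and Frobenius `F f(z) = f(z^p)`. The first column `(m₁₁, m₂₁)` of the matrix of `F` is then
characterised by: `F f₁ − m₁₁·f₁ − m₂₁·f₂` has `p`-integral coefficients (`IsKatzFrobeniusColumn`).
ENGINE CHECK (kit j340986, engine43, 1831 curves; CensusAN43.md commit 5d777d4fac1d, sha16
dae6e95df3d09ae9): this recipe reproduces PARI's `ellpadicfrobenius` on all 403 supersingular control
pairs at `p = 3, 5` to 2 digits («direct» convention; transpose / V-conventions rejected 403/403),
gives `trace = a₂`, `det = 2`, `v₂(m₂₁) = 1`, `m₁₂` odd on 1831/1831 at `p = 2`, and determines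
`m₂₁ mod 16` from `N ≤ 770`.

* `FlatBlindUnitFrobeniusAtChi8` (P-an-42C): for EVERY good-supersingular `E` (`a₂ ∈ {0, ±2}`, no case
  split) on the odd locus with `r_an(E^{(2)}) = 1`: `unit(b) · m₂₁ ≡ −2 · Tam(W₂)_odd (mod 16)`.
  CENSUS (CensusAN43 §3): 1509/1509 certified rows (a₂ = −2: 381, 0: 726, +2: 402), 0 exceptions.
* `KatzFrobeniusUnitLaw` / `KatzFrobeniusUnitLawZero` (L-42, purely LOCAL, no L-function): for a
  globally minimal good-ss `W`, `m₂₁ · ((a₂/2)(c₄/8+1)+2) ≡ −2 (mod 16)` (`a₂ = ±2`), resp.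
  `m₂₁ ≡ 14 / 10 (mod 16)` as `Δ_min ≡ 13 / 5 (mod 16)` (`a₂ = 0`) — CensusAN43 §4: 1830/1830 census
  curves, 0 violations (the other entries m₁₁, m₁₂, m₂₂ mod 8 are NOT class functions). With P-an-42C these give
  back P-an-42A / P-an-42B (`BlindFlatUnitAN54`); they are finite 2-adic statements about formal groups
  of supersingular Weierstrass models and should be decidable by computation.
* `KatzFrobeniusDepthLaw` (P-an-42D): the whole Frobenius matrix mod `2^(k+1)` is a function of the
  minimal model mod `2^k` (one bit more than the crystalline comparison gives); data k = 1, 2, 3 on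
  1831 curves (CensusAN43 §6). `IsKatzFrobeniusSecondColumn` is the second-column predicate.
-/

noncomputable section

open scoped Classical MatrixGroups ModularForm

open PowerSeries WeierstrassCurve CongruenceSubgroup Literature.NumberTheory.EllipticCurves
  Literature.NumberTheory.EllipticCurves.ModularForms Literature.NumberTheory.EllipticCurves.Sprung2017
  Literature.NumberTheory.EllipticCurves.Rank1Residual
  Summit.BirchSwinnertonDyer.Rank1Residual.Supersingular
  Summit.BirchSwinnertonDyer.Rank1Residual.Supersingular.BlindLever

namespace Summit.BirchSwinnertonDyer.Cruxes.RankOneAtTwoBigImageOddLocal.BlindUnitAN55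

/-- The regularised integral of the second-kind differential `η = x·ω` on the formal group:
`f₂(z) = Σ_{N ≥ 1} (d(N)/N) z^N` where `x(z)·ω(z)/dz = z⁻² + Σ_{N ≥ 1} d(N) z^{N-1}`, i.e.
`d(N) = coeff (N+1) (z²x(z) · ω(z)/dz)`; the polar term `−z⁻¹` of `∫η` is dropped (canonical modulo
integral series) and the residue term vanishes. [Katz 1981 §5 (quasi-logarithms of `Ê`)] [folklore] -/
def formalEtaIntegral {A : Type*} [CommRing A] [Algebra ℚ A] (V : WeierstrassCurve A) : A⟦X⟧ :=
  PowerSeries.mk fun N =>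
    if N = 0 then 0 else algebraMap ℚ A (1 / (N : ℚ)) * coeff (N + 1) (V.formalXMulSq * V.formalOmega)

/-- The Frobenius lift `f(z) ↦ f(z²)` on power series. [Katz 1981 §3] [folklore] -/
def frobTwo {A : Type*} [CommRing A] (g : A⟦X⟧) : A⟦X⟧ :=
  PowerSeries.mk fun n => if 2 ∣ n then coeff (n / 2) g else 0

/-- `2`-adic integrality of a power series over `ℚ_[2]`. [folklore] -/
def IsTwoAdicIntegral (g : ℚ_[2]⟦X⟧) : Prop := ∀ n : ℕ, ‖coeff n g‖ ≤ 1

/-- **Katz's first Frobenius column.** For a Weierstrass model `V/ℚ_[2]` (integral, good supersingular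
reduction intended), `(m₁₁, m₂₁) ∈ ℤ_[2]²` is the first column of the matrix of the crystalline
Frobenius `φ` on `H¹_dR = D(Ê)` in the basis `(ω, η = x·ω)` iff `F(log_V) − m₁₁·log_V − m₂₁·f₂` has
`2`-integral coefficients (generalized Atkin–Swinnerton-Dyer congruences:
`c(N)·m₁₁ + d(N)·m₂₁ ≡ 2·c(N/2) (mod 2^{v₂ N})`). [Katz 1981, Thm. 5.x / ASD congruences] [folklore] -/
def IsKatzFrobeniusColumn (V : WeierstrassCurve ℚ_[2]) (m₁₁ m₂₁ : ℤ_[2]) : Prop :=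
  IsTwoAdicIntegral
    (frobTwo V.formalLog - C (m₁₁ : ℚ_[2]) * V.formalLog - C (m₂₁ : ℚ_[2]) * formalEtaIntegral V)

/-- **Katz's second Frobenius column**: `(m₁₂, m₂₂)` is the second column of `φ` in the basis
`(ω, η)` iff `F(f₂) − m₁₂·log_V − m₂₂·f₂` is `2`-integral (`c(N)·m₁₂ + d(N)·m₂₂ ≡ 2·d(N/2)`).
Engine-validated together with the first column (PARI `ellpadicfrobenius`, p = 3, 5, 403/403
supersingular pairs). [Katz 1981 §5] [folklore] -/
def IsKatzFrobeniusSecondColumn (V : WeierstrassCurve ℚ_[2]) (m₁₂ m₂₂ : ℤ_[2]) : Prop :=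
  IsTwoAdicIntegral
    (frobTwo (formalEtaIntegral V) - C (m₁₂ : ℚ_[2]) * V.formalLog - C (m₂₂ : ℚ_[2]) * formalEtaIntegral V)

/-- **P-an-42D `KatzFrobeniusDepthLaw`** (MEMO-an §42.6(d), CensusAN43 §6): for globally minimal
good-supersingular-at-2 curves, the crystalline Frobenius matrix at 2 in the basis `(ω, η = x·ω)` taken
modulo `2^(k+1)` depends only on the integral minimal model modulo `2^k` — ONE BIT MORE than the model.
DATA (kit j340986, 1831 curves, all four entries known mod 16): model mod 2 ↦ matrix mod 4 (8 classes),
mod 4 ↦ mod 8 (48 classes), mod 8 ↦ mod 16 (192 classes), purity 1.000 each; model mod 2 does NOT fix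
the matrix mod 8, nor mod 4 the matrix mod 16. (For `m₂₁` alone the data give two extra bits: model
mod 4 ↦ `m₂₁ mod 16`, which is L-42.) Why it might fail: the crystalline comparison gives agreement
mod `2^k` for free (functoriality of `H¹_cris` over the PD-thickening `ℤ/2^k`); the extra bit is the
conjecture and is witnessed only on Cremona-reduced models (`a₁ = 0, a₃ = 1`) for `k ≤ 3`; a pair of
lifts congruent mod 16 with matrices differing mod 32 kills it (testable with engine43 at NTERMS ≈ 2100).
[conjecture; this note §42.6(d)] -/
@[conjecture] def KatzFrobeniusDepthLaw : Prop :=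
  ∀ (k : ℕ), 1 ≤ k →
  ∀ (W W' : WeierstrassCurve ℚ) [W.IsElliptic] [W'.IsElliptic] [W.IsGloballyMinimal] [W'.IsGloballyMinimal],
    GoodSS W 2 → GoodSS W' 2 →
    (integralModelInt W).a₁ ≡ (integralModelInt W').a₁ [ZMOD 2 ^ k] →
    (integralModelInt W).a₂ ≡ (integralModelInt W').a₂ [ZMOD 2 ^ k] →
    (integralModelInt W).a₃ ≡ (integralModelInt W').a₃ [ZMOD 2 ^ k] →
    (integralModelInt W).a₄ ≡ (integralModelInt W').a₄ [ZMOD 2 ^ k] →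
    (integralModelInt W).a₆ ≡ (integralModelInt W').a₆ [ZMOD 2 ^ k] →
    ∀ (m₁₁ m₂₁ m₁₂ m₂₂ n₁₁ n₂₁ n₁₂ n₂₂ : ℤ_[2]),
      IsKatzFrobeniusColumn (W.map (Rat.castHom ℚ_[2])) m₁₁ m₂₁ →
      IsKatzFrobeniusSecondColumn (W.map (Rat.castHom ℚ_[2])) m₁₂ m₂₂ →
      IsKatzFrobeniusColumn (W'.map (Rat.castHom ℚ_[2])) n₁₁ n₂₁ →
      IsKatzFrobeniusSecondColumn (W'.map (Rat.castHom ℚ_[2])) n₁₂ n₂₂ →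
        PadicInt.toZModPow (k + 1) m₁₁ = PadicInt.toZModPow (k + 1) n₁₁ ∧
        PadicInt.toZModPow (k + 1) m₂₁ = PadicInt.toZModPow (k + 1) n₂₁ ∧
        PadicInt.toZModPow (k + 1) m₁₂ = PadicInt.toZModPow (k + 1) n₁₂ ∧
        PadicInt.toZModPow (k + 1) m₂₂ = PadicInt.toZModPow (k + 1) n₂₂

/-- **P-an-42C `FlatBlindUnitFrobeniusAtChi8`** (MEMO-an §42.6): the blind flat unit law as ONE
statement for all good-supersingular `E` (`a₂ ∈ {0, ±2}`). Setting of `BlindFlatUnitAN54`: newform `f`,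
Sprung pair `(Ls, Lf)` at `2`, odd-twist locus `w(E)·χ₈(N_E) = −1`, globally minimal model `W₂` of
`E^{(2)}` with `r_an = 1`; `(m₁₁, m₂₁)` Katz's first Frobenius column of the (globally minimal) model
`W` over `ℚ_[2]`; writing `evalAt (−2) Lf = u·2ⁿ` (`u ∈ ℤ₂ˣ`, unique; vacuous iff the value is `0`):
`u · m₂₁ ≡ −2 · Tam(W₂)_odd (mod 16)` (so `v₂(m₂₁) = 1` and `u·(m₂₁/2) ≡ −Tam_odd (mod 8)`).
`m₂₁ mod 16` is invariant under `ℤ`-isomorphisms of minimal models (`m₂₁ ↦ u⁻²m₂₁`, `u = ±1`).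
Engine census (Katz–ASD engine43 vs the blind-value engines): MEMO-an §42.6. [conjecture] -/
@[conjecture] def FlatBlindUnitFrobeniusAtChi8 : Prop :=
  ∀ (W : WeierstrassCurve ℚ) [W.IsElliptic] [W.IsGloballyMinimal] [NeZero (W.conductorNorm ℤ)]
    (f : CuspForm (Gamma0 (W.conductorNorm ℤ)) 2),
    IsNewformOf W f → GoodSS W 2 →
    W.rootNumber * ZMod.χ₈ (W.conductorNorm ℤ : ZMod 8) = -1 →
    ∀ (Ls Lf : IwasawaAlgebra 2), IsSprungPair f 2 (W.frobeniusTrace 2) Ls Lf →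
    ∀ (W₂ : WeierstrassCurve ℚ) [W₂.IsElliptic] [W₂.IsGloballyMinimal],
      (∃ C : WeierstrassCurve.VariableChange ℚ, C • W.quadraticTwist 2 = W₂) →
      W₂.analyticRank = 1 →
    ∀ (m₁₁ m₂₁ : ℤ_[2]), IsKatzFrobeniusColumn (W.map (Rat.castHom ℚ_[2])) m₁₁ m₂₁ →
    ∀ (u : ℤ_[2]ˣ) (n : ℕ), evalAt (-2 : ℤ_[2]) Lf = (u : ℤ_[2]) * 2 ^ n →
      PadicInt.toZModPow 4 ((u : ℤ_[2]) * m₂₁) =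
        -2 * ((W₂.tamagawaProduct / 2 ^ padicValNat 2 W₂.tamagawaProduct : ℕ) : ZMod (2 ^ 4))

/-- **L-42 `KatzFrobeniusUnitLaw`** (MEMO-an §42.6, purely local): for a globally minimal `W/ℚ` with
good supersingular reduction at `2` and `a₂ = ±2`, Katz's Frobenius entry satisfies
`m₂₁ · ((a₂/2)·(c₄/8 + 1) + 2) ≡ −2 (mod 16)` (`c₄` of the integral model; `c₄ ≡ 16 mod 32`).
With P-an-42C this is P-an-42A. Engine census: MEMO-an §42.6. [conjecture] -/
@[conjecture] def KatzFrobeniusUnitLaw : Prop :=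
  ∀ (W : WeierstrassCurve ℚ) [W.IsElliptic] [W.IsGloballyMinimal],
    GoodSS W 2 → W.frobeniusTrace 2 ≠ 0 →
    ∀ (m₁₁ m₂₁ : ℤ_[2]), IsKatzFrobeniusColumn (W.map (Rat.castHom ℚ_[2])) m₁₁ m₂₁ →
      PadicInt.toZModPow 4 m₂₁ *
          (((W.frobeniusTrace 2 / 2) * ((integralModelInt W).c₄ / 8 + 1) + 2 : ℤ) : ZMod (2 ^ 4)) = -2

/-- **L-42′ `KatzFrobeniusUnitLawZero`** (MEMO-an §42.6, purely local): same with `a₂ = 0`: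
`Δ_min ≡ 13 (mod 16) ⇒ m₂₁ ≡ 14 (mod 16)` and `Δ_min ≡ 5 (mod 16) ⇒ m₂₁ ≡ 10 (mod 16)`.
With P-an-42C this is P-an-42B. Engine census: MEMO-an §42.6. [conjecture] -/
@[conjecture] def KatzFrobeniusUnitLawZero : Prop :=
  ∀ (W : WeierstrassCurve ℚ) [W.IsElliptic] [W.IsGloballyMinimal],
    GoodSS W 2 → W.frobeniusTrace 2 = 0 →
    ∀ (m₁₁ m₂₁ : ℤ_[2]), IsKatzFrobeniusColumn (W.map (Rat.castHom ℚ_[2])) m₁₁ m₂₁ →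
      (minimalDiscriminantInt W % 16 = 13 → PadicInt.toZModPow 4 m₂₁ = 14) ∧
      (minimalDiscriminantInt W % 16 = 5 → PadicInt.toZModPow 4 m₂₁ = 10)

/-- Kernel check that L-42 + P-an-42C reproduce the P-an-42A table: in `ZMod 16`, for each residue
`T ∈ {7, 3, 5, 1}` of `(a₂/2)(c₄/8+1)+2` the unique `m ∈ {2, 6, 10, 14}` with `m·T = −2` is
`m = 2, 10, 6, 14`, and then `u·m = −2·t ↔ u = T·t (mod 8)` for every odd `t` and odd `u`. [folklore] -/
theorem table42A_of_42C :
    ((2 : ZMod 16) * 7 = -2 ∧ (10 : ZMod 16) * 3 = -2 ∧ (6 : ZMod 16) * 5 = -2 ∧ (14 : ZMod 16) * 1 = -2) ∧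
    (∀ u t : ZMod 16, u * u = 1 ∨ u * u = 9 → (t * t = 1 ∨ t * t = 9) →
      ((u * 2 = -2 * t ↔ (u - 7 * t) * 2 = 0) ∧ (u * 10 = -2 * t ↔ (u - 3 * t) * 2 = 0) ∧
       (u * 6 = -2 * t ↔ (u - 5 * t) * 2 = 0) ∧ (u * 14 = -2 * t ↔ (u - 1 * t) * 2 = 0))) := by
  refine ⟨by decide, ?_⟩
  decide

end Summit.BirchSwinnertonDyer.Cruxes.RankOneAtTwoBigImageOddLocal.BlindUnitAN55
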